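import Mathlib
import HarnessLib

/-!
# Route `UniversalToricDescent`, crux `AdditiveSplitIMCInclusionAtThree` (item stmt-BirchSwinnertonDyer-20395):
# the THIN-COMB + REFLECTION vocabulary of crux idea `thin-comb-reflection` as an importable module (definitions)
# (cell `pub/bsd-wall`, lead prover `cruxlead-stmt-BirchSwinnertonDyer-20395`; `--supports stmt-BirchSwinnertonDyer-20395`)

WHY THIS FILE. Crux idea `thin-comb-reflection` (planner `bsd-wall-utd-idea` g38; card
`Cruxes/AdditiveSplitIMCInclusionAtThree/Ideas/thin-comb-reflection.md`, sketch
`Cruxes/AdditiveSplitIMCInclusionAtThree/thin_comb_reflection_sketch.lean`) reduces the wall to a pure-algebra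
RIGIDITY LEMMA (card item K1) in the two-variable power-series ring `Λ₂(𝒪) = 𝒪⟦T₂⟧⟦T₁⟧`: divisibility `G ∣ p^{t}·F`
on the THIN COMB of lines `T₂ = ζ − 1` (`ζ` of unbounded `p`-power order) together with the symmetry of `G` and `F`
under a REFLECTION `ρ` (`1 + T₁ ↦ (1 + T₂)⁻¹`, `1 + T₂ ↦ (1 + T₁)⁻¹`) forces `G ∣ p^a·F` in `Λ₂(𝒪)`. A sketch under
`Cruxes/` is not an importable module, so the lemma cannot be PROVED by name unless its vocabulary lives under
`Theorems/`; this file is that vocabulary, the companion file `UniversalToricDescentThinCombRigidity.lean` proves the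
lemma for every discrete valuation ring `𝒪` with maximal ideal `(p)` (e.g. `ℤ_[p]`, `R₀ = unrIntegers p`).

DESIGN (one deliberate change w.r.t. the sketch, same mathematics). The sketch states comb divisibility line by line
over every `𝒪`-algebra domain `O'` holding a primitive `p^{m+1}`-th root of unity `ζ` (divisibility modulo the vertical
prime `T₂ − (ζ − 1)` of `Λ₂(O')`). Since `G, F` have coefficients in `𝒪`, divisibility on one such line is divisibility
on all its Galois conjugates, i.e. divisibility modulo the `𝒪`-RATIONAL vertical element
`E_m(T₂) = Φ_{p^{m+1}}(1 + T₂)` (whose roots are exactly the `ζ − 1`). We state the comb hypothesis in this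
`𝒪`-rational form — `p^t·F ∈ (G, E_m(T₂))` in `Λ₂(𝒪)` — which needs no coefficient extension and is the shape a
Beilinson–Flach / Kolyvagin-system argument per `p`-power twist delivers (card item K2). Coordinates follow the tree's
`IwasawaAlgebra₂` convention: OUTER variable `T₁ = PowerSeries.X`, INNER variable `T₂ = C X`.

CONTENTS (definitions only; nothing asserted; no instance; no notation; no `sorry`):
* `combPoly p m = Φ_{p^{m+1}}(1 + X) ∈ ℤ[X]` (Eisenstein at `p`, monic of degree `φ(p^{m+1})`, constant term `p`);
  `combSeries 𝒪 p m` = the same in `𝒪⟦X⟧`; `combElt 𝒪 p m = E_m(T₂) ∈ Λ₂(𝒪)`; `LevelRing 𝒪 p m = 𝒪⟦X⟧ ⧸ (E_m)`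
  (`≅ 𝒪[ζ_{p^{m+1}}]`, the coordinate ring of the comb line of level `m`);
* `T₁`, `T₂`, `const` (coordinates and constants of `Λ₂(𝒪)`);
* `ThinCombDvdRat 𝒪 p G F` / `ThinCombDvdInt 𝒪 p G F` (comb divisibility on levels of unbounded order, with /
  without a `p`-power slack); `IsReflection 𝒪 ρ` (verbatim the sketch's three clauses);
* `CombReflectionRigidityRat 𝒪 p` / `CombReflectionRigidityInt 𝒪 p` (the lemma, rational and integral forms).

HONEST FRAMING. This is vocabulary for ONE support item (K1) of an IDEA on the wall; the wall itself
(`AdditiveSplitIMCInclusionAtThree`), the comb supply (K2), the two-variable `p`-adic `L`-function and its functional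
equation (K3) and the two-variable algebraic functional equation (K4) are NOT addressed here. BSD is not proved by any
of this.

References: Washington, *Introduction to Cyclotomic Fields*, §7.1–7.2 (distinguished polynomials, `Λ = ℤ_p⟦T⟧`)
[cite: Washington1997, §7.1–§7.2]; Büyükboduk–Lei, arXiv:1707.00557, Def. 3.8 (the involution `γ ↦ c γ⁻¹ c`).
-/

-- single-conjunct summit: `Summit.BirchSwinnertonDyer.BirchSwinnertonDyer.…` repeats the name by design
set_option linter.dupNamespace false

noncomputable section

namespace Summit.BirchSwinnertonDyer.BirchSwinnertonDyer.Theorems.UniversalToricDescentThinComb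

open Polynomial

/-! ## §1 The vertical elements `E_m = Φ_{p^{m+1}}(1 + X)` and the level rings -/

/-- `E_m(X) = Φ_{p^{m+1}}(1 + X) ∈ ℤ[X]`: the minimal polynomial of `ζ − 1` for `ζ` a primitive `p^{m+1}`-th root of
unity; Eisenstein at `p` (Mathlib `cyclotomic_prime_pow_comp_X_add_one_isEisensteinAt`), monic of degree
`φ(p^{m+1})`, constant term `Φ_{p^{m+1}}(1) = p`. Its zero locus `E_m(T₂) = 0` in the open bidisc is the union of the
comb lines `T₂ = ζ − 1` of level `m`. [cite: Washington1997, Lemma 1.4 and §7.1] -/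
def combPoly (p m : ℕ) : ℤ[X] := (cyclotomic (p ^ (m + 1)) ℤ).comp (X + 1)

variable (𝒪 : Type*) [CommRing 𝒪]

/-- `E_m ∈ 𝒪⟦X⟧`: the polynomial `combPoly p m` with coefficients cast to `𝒪`, as a power series (a DISTINGUISHED
polynomial when `p` lies in the maximal ideal of a local `𝒪`). [cite: Washington1997, §7.1] -/
def combSeries (p m : ℕ) : PowerSeries 𝒪 :=
  (((combPoly p m).map (Int.castRingHom 𝒪) : 𝒪[X]) : PowerSeries 𝒪)

/-- `E_m(T₂) ∈ Λ₂(𝒪) = 𝒪⟦T₂⟧⟦T₁⟧`: the vertical element of level `m` (constant in the outer variable `T₁`). The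
ideal `(G, E_m(T₂))` records `G` restricted to all comb lines `T₂ = ζ − 1` of level `m` at once.
[cite: Washington1997, §7.1] -/
def combElt (p m : ℕ) : PowerSeries (PowerSeries 𝒪) := PowerSeries.C (combSeries 𝒪 p m)

/-- The LEVEL RING `𝒪_m = 𝒪⟦X⟧ ⧸ (E_m)` — for `𝒪` a complete DVR with maximal ideal `(p)` this is `𝒪[ζ_{p^{m+1}}]`,
the (totally ramified) coordinate ring of the comb line of level `m`, with uniformiser the class `ϖ_m` of `X`
(`= ζ − 1`) and `p ∼ ϖ_m^{φ(p^{m+1})}`. Reducing inner coefficients modulo `E_m` maps `Λ₂(𝒪) → 𝒪_m⟦T₁⟧`.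
[cite: Washington1997, Lemma 1.4 and Prop. 7.2] -/
abbrev LevelRing (p m : ℕ) : Type _ := PowerSeries 𝒪 ⧸ Ideal.span {combSeries 𝒪 p m}

/-! ## §2 Coordinates of `Λ₂(𝒪) = 𝒪⟦T₂⟧⟦T₁⟧ = PowerSeries (PowerSeries 𝒪)` -/

/-- Outer variable `T₁` (`= γ_𝔭 − 1` in the idea card's dictionary). [cite: Washington1997, §7.1] -/
def T₁ : PowerSeries (PowerSeries 𝒪) := PowerSeries.X

/-- Inner variable `T₂` (`= γ_𝔭' − 1`). [cite: Washington1997, §7.1] -/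
def T₂ : PowerSeries (PowerSeries 𝒪) := PowerSeries.C PowerSeries.X

/-- Constants `𝒪 →+* Λ₂(𝒪)`. [cite: Washington1997, §7.1] -/
def const : 𝒪 →+* PowerSeries (PowerSeries 𝒪) :=
  (PowerSeries.C (R := PowerSeries 𝒪)).comp (PowerSeries.C (R := 𝒪))

/-! ## §3 Thin-comb divisibility, reflections, rigidity -/

/-- **Rational thin-comb divisibility** `G ∣ p^{t_m}·F` on comb levels `m` of UNBOUNDED order: for every `n` there is a
level `m ≥ n` and a slack `t` with `p^t·F ∈ (G, E_m(T₂))` in `Λ₂(𝒪)`, i.e. `G` divides `p^t F` on (all Galois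
conjugates of) the line `T₂ = ζ_{p^{m+1}} − 1`. This is what ONE Euler-system argument per `p`-power twist delivers
(card `thin-comb-reflection`, item K2). [cite: Washington1997, §7.1] -/
def ThinCombDvdRat (p : ℕ) (G F : PowerSeries (PowerSeries 𝒪)) : Prop :=
  ∀ n : ℕ, ∃ m : ℕ, n ≤ m ∧ ∃ t : ℕ, const 𝒪 ((p : 𝒪) ^ t) * F ∈ Ideal.span {G, combElt 𝒪 p m}

/-- **Integral thin-comb divisibility**: the same without slack, `F ∈ (G, E_m(T₂))` on levels of unbounded order
(card item K2⁺). [cite: Washington1997, §7.1] -/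
def ThinCombDvdInt (p : ℕ) (G F : PowerSeries (PowerSeries 𝒪)) : Prop :=
  ∀ n : ℕ, ∃ m : ℕ, n ≤ m ∧ F ∈ Ideal.span {G, combElt 𝒪 p m}

/-- **A reflection of `Λ₂(𝒪)`** (verbatim the sketch's clauses): a ring automorphism with
`(1 + T₂)·(1 + ρ T₁) = 1`, `(1 + T₁)·(1 + ρ T₂) = 1` and fixing constants — the substitution `γ ↦ c γ⁻¹ c`
(Büyükboduk–Lei's involution `τ`), which fixes the anticyclotomic line `(1 + T₁)(1 + T₂) = 1` pointwise and exchanges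
the comb `T₂ = ζ − 1` with the transverse comb `T₁ = ζ⁻¹ − 1`. The rigidity lemma uses only that `ρ` fixes constants
and maps the ideal `(p, T₁)` onto `(p, T₂)`. [cite: Washington1997, §13.4 (Γ-action conventions)] -/
def IsReflection (ρ : PowerSeries (PowerSeries 𝒪) ≃+* PowerSeries (PowerSeries 𝒪)) : Prop :=
  (1 + T₂ 𝒪) * (1 + ρ (T₁ 𝒪)) = 1 ∧ (1 + T₁ 𝒪) * (1 + ρ (T₂ 𝒪)) = 1 ∧ ∀ c : 𝒪, ρ (const 𝒪 c) = const 𝒪 c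

/-- **THIN-COMB + REFLECTION RIGIDITY, rational form** (card item K1): if `G` and `F` are `ρ`-symmetric up to units
for a reflection `ρ` and `G ∣ p^{t_m} F` on comb levels of unbounded order, then `G ∣ p^a F` in `Λ₂(𝒪)` for some `a`.
Proved for every DVR `𝒪` with maximal ideal `(p)` in `UniversalToricDescentThinCombRigidity.lean`.
[cite: Washington1997, Prop. 7.2 and Thm. 7.3 (structure of `Λ`)] -/
def CombReflectionRigidityRat (p : ℕ) : Prop :=
  ∀ ρ : PowerSeries (PowerSeries 𝒪) ≃+* PowerSeries (PowerSeries 𝒪), IsReflection 𝒪 ρ →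
    ∀ G F : PowerSeries (PowerSeries 𝒪), Associated (ρ G) G → Associated (ρ F) F →
      ThinCombDvdRat 𝒪 p G F → ∃ a : ℕ, G ∣ const 𝒪 ((p : 𝒪) ^ a) * F

/-- **THIN-COMB + REFLECTION RIGIDITY, integral form** (card item K1, door for the wall by name): with INTEGRAL comb
divisibility the power of `p` is detected too, so `G ∣ F`. Proved for every DVR `𝒪` with maximal ideal `(p)` in
`UniversalToricDescentThinCombRigidity.lean`. [cite: Washington1997, Prop. 7.2 and Thm. 7.3 (structure of `Λ`)] -/
def CombReflectionRigidityInt (p : ℕ) : Prop :=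
  ∀ ρ : PowerSeries (PowerSeries 𝒪) ≃+* PowerSeries (PowerSeries 𝒪), IsReflection 𝒪 ρ →
    ∀ G F : PowerSeries (PowerSeries 𝒪), Associated (ρ G) G → Associated (ρ F) F →
      ThinCombDvdInt 𝒪 p G F → G ∣ F

end Summit.BirchSwinnertonDyer.BirchSwinnertonDyer.Theorems.UniversalToricDescentThinComb

end
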